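import Literature.IUT.LogVolume.MultiradialRegion
import Mathlib.Tactic.Linarith
import HarnessLib

/-!
# The fork at [IUTchIII] Corollary 3.12, L-DH level (c312-3), II-a: Dupuy–Hilado data for Cor. 3.12 and
# the inequality (1.1) as `Cor312DH` — over CONSTRUCTED Literature objects only

Record-only file (D-0012) of the abc-iut cell (Cor. 3.12 sub-crew, seat abc-iut-c312-3; `plan/LDH-SPEC.md`
D7–D9 / TRANCHE-T1 P10; cell deliverable D-0060 "`Cor312` (DH form …) elaborating in Summits/ABC/IUTFork with
every constant resolving to a landed or filed Literature/IUT decl"); TAKES NO SIDE. Every constant below is a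
decl of `Literature/IUT/LogVolume/{PilotDivisors, FakeAdeleIndex, DegreeVolumeConversion, MultiradialRegion}`
(Dupuy–Hilado arXiv:2004.13228 §2–§4 typed on Mathlib); the skeleton's interface nouns
(`ForkRegions.Cor312Setting`, `ForkInflation.PilotCalibration`) are instantiated from the SAME data in the
sequel `LDHCor312Skel` (which waits for those skeleton files to land); nothing here depends on them.

* `DHData` — HYPOTHESIS structure: pilot data `(F, j_E, S, l)` (`PilotData`), a packet model with
  indeterminacy transports (`IndPacketModel`: summands `K_{v̲_0} ⊗ ⋯ ⊗ K_{v̲_j}` of `𝕃`, normalised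
  log-measures, `O`, peel actions, log-shells, (Ind1) transports, (Ind2) groups, local hulls — an
  INTERFACE whose fields quote DH print; a model from Mathlib's completions is
  `Literature.IUT.LogVolume.completionModel`), the finite set of primes `T` under `S`, a theta-idele and a
  `q`-idele realising `P_Θ`, `P_q` (§3.9 "`a` such that `div(a) = D`"), an (Ind3)-datum (§4.10), and
  admissibility of `hull(U_Θ)` (the one datum Cor. 3.12 itself asserts: "`−|log(Θ)| ∈ ℝ`").
* PROVED from DH Thm. 3.10.1 (`PacketModel.lnνL_region_eq_neg_ndegLgp`): `lnνL_regionΘ`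
  (`ln ν̄_𝕃(O_𝕃(−P_Θ)) = −deĝ̲_lgp(P_Θ)`), `lnνL_regionq` (`ln ν̄_𝕃(O_𝕃(−P_q)) = −deĝ̲(P_q)`), via the divisor
  bookkeeping `sum_sum_placesOver_of` / `div_tΘ` / `div_tq`.
* `Cor312DH` := Dupuy–Hilado (1.1) "`−deĝ(P_q) ≤ −deĝ_lgp(P_{hull(U_Θ)})`" with "`ln ν̄_𝕃(hull(U_Θ)) =
  −deĝ_lgp(P_{hull(U_Θ)})`" (p. 4), i.e. `−deĝ̲(P_q) ≤ ln ν̄_𝕃(hull(U_Θ))` — HYPOTHESIS, never asserted; and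
  what it costs, PROVED: `cor312DH_iff_inflation` ((1.1) ⟺ (Ind3)+(Ind1)+(Ind2)+hull inflate `O_𝕃(−P_Θ)` by
  at least `deĝ̲_lgp(P_Θ) − deĝ̲(P_q) > 0`), `free_inequality` (`−deĝ̲_lgp(P_Θ) ≤ ln ν̄_𝕃(hull(U_Θ))`
  regardless), `lnνL_eq_of_indRel` (`ln ν̄_𝕃` constant on (Ind1)/(Ind2)-orbits), `EstimateDH` + the squeeze
  `ndeg_qPilot_le_of_squeeze` (`deĝ̲(P_q) ≤ δ/(w̄ − 1)`, `w̄ = (ℓ⋇+1)(2ℓ⋇+1)/6`).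

Sources read on the page: Dupuy–Hilado arXiv:2004.13228 (pre-split text) §1 pp. 3–4, §3.5–3.10, §4.7–4.12
(render `paper:arxiv-2004.13228` chunks 3–4, 8–16); [IUTchIII] Thm. 3.11 (i) (Ind1), (Ind2) p. 154, (ii)
(Ind3) p. 156 (kurims `paper:url-4b091feeb646`), Cor. 3.12 pp. 173–174 as transcribed in the cell's
`plan/COR312-TEXT.md`. [cite: DupuyHilado2025, §1 (1.1), §3.9, Thm. 3.10.1, §4.10–4.12]
[claim: Mochizuki2012, status: disputed]
Deliberately NOT here: a tensor-packet `IndPacketModel` from `p`-adic fields (campaign seats abc-iut-S1/S2);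
the skeleton instantiation (`LDHCor312Skel`); whether [IUTchIII] Thm. 3.11 licenses (1.1) (the dispute);
any judgement. Non-vacuity (both truth values of `Cor312DH` over `ℚ`): `LDHWitness`.
-/

noncomputable section

open Set Finset

namespace Summit.ABC.IUTFork

open Literature.IUT.LogVolume NumberField IsDedekindDomain
open scoped Pointwise

variable {F : Type} [Field F] [NumberField F]

/-! ## 1. Regions of `𝕃` as subsets of the disjoint union of the summands -/

namespace RegionEncoding

variable (M : PacketModel F)

/-- The index of a summand of `𝕃`: `(p, j, v⃗)`. [cite: DupuyHilado2025, Def. 3.6.3] -/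
abbrev Idx : Type := Σ p : ℕ, Σ j : ℕ, (Fin (j + 1) → placesOver F p)

/-- The carrier `𝕃` as a set: the disjoint union of the summands `X_{v⃗}`. [cite: DupuyHilado2025, Def. 3.6.3] -/
abbrev Carrier : Type := Σ s : Idx (F := F), M.X s.1 s.2.1 s.2.2

/-- A subset of `𝕃` read summandwise = a random measurable set `(U_s)_s` (DH Rmk. 3.5.2: "we will conflate
`(U_s)_{s∈S}` … with `Π_s U_s ⊂ X`"; subsets of the DISJOINT union correspond exactly to families).
[cite: DupuyHilado2025, Rmk. 3.5.2] -/
def ofSet (A : Set (Carrier M)) : M.Region := fun p j e => {y | (⟨⟨p, j, e⟩, y⟩ : Carrier M) ∈ A}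

/-- A family of summand regions as a subset of `𝕃`. [cite: DupuyHilado2025, Rmk. 3.5.2] -/
def toSet (B : M.Region) : Set (Carrier M) := {x | x.2 ∈ B x.1.1 x.1.2.1 x.1.2.2}

/-- `ofSet ∘ toSet = id`. [folklore] -/
theorem ofSet_toSet (B : M.Region) : ofSet M (toSet M B) = B := rfl

/-- `toSet ∘ ofSet = id`. [folklore] -/
theorem toSet_ofSet (A : Set (Carrier M)) : toSet M (ofSet M A) = A := by
  ext ⟨⟨p, j, e⟩, y⟩; rfl

/-- `ofSet` is monotone. [folklore] -/
theorem ofSet_mono {A A' : Set (Carrier M)} (h : A ⊆ A') (p j : ℕ) (e : Fin (j + 1) → placesOver F p) :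
    ofSet M A p j e ⊆ ofSet M A' p j e := fun _ hy => h hy

/-- `toSet` is monotone. [folklore] -/
theorem toSet_mono {B B' : M.Region} (h : ∀ p j e, B p j e ⊆ B' p j e) : toSet M B ⊆ toSet M B' :=
  fun _ hx => h _ _ _ hx

/-- `ofSet` of a union is the summandwise union. [folklore] -/
theorem ofSet_iUnion {ι : Type*} (A : ι → Set (Carrier M)) (p j : ℕ) (e : Fin (j + 1) → placesOver F p) :
    ofSet M (⋃ i, A i) p j e = ⋃ i, ofSet M (A i) p j e := by
  ext y; simp [ofSet]

end RegionEncoding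

/-! ## 2. Dupuy–Hilado data for Corollary 3.12 -/

/-- **Dupuy–Hilado data for Cor. 3.12** (HYPOTHESIS structure, L-DH level): real pilot data `(F, j_E, S, l)`;
a packet model with indeterminacy transports; a finite set `T` of primes containing the residue
characteristics of `S` (the support of the pilot divisors); a THETA-IDELE `t_Θ` and a `q`-IDELE `t_q`
with `ord_v(t_{Θ,j,v}) =` the coefficient of `P_{Θ,j}` at `v` and `ord_v(t_{q,j,v}) =` that of `P_q`
(§3.9 "let `a = (a_{v̲}) ∈ 𝔸_{V̲}` be such that `D = div(a)`"; Thm. 3.10.1's hypothesis `D ∈ Div̂_{ℤ[1/d]}`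
is what makes such `a` exist in `K_{v̲}`); an (Ind3)-datum for `t_Θ` (§4.10); and ADMISSIBILITY OF
`hull(U_Θ)` — "`ln ν̄_𝕃(hull(U_Θ)) = −deĝ_lgp(P_{hull(U_Θ)})`" ∈ ℝ (p. 4), [IUTchIII] Cor. 3.12 "it holds
that `−|log(Θ)| ∈ ℝ`" (the skeleton's datum `Cor312Setting.Uhol_adm`). Nothing asserted.
[cite: DupuyHilado2025, §3.9, §4.10–4.12] -/
structure DHData (F : Type) [Field F] [NumberField F] where
  /-- the pilot data `(F, j_E, S, l)` -/
  X : PilotData F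
  /-- the packets of `𝕃` with (Ind1)/(Ind2) transports, log-shells, local hulls -/
  M : IndPacketModel F
  /-- the primes over which `ln ν̄_𝕃` is summed -/
  T : Finset ℕ
  /-- they are primes -/
  T_prime : ∀ p ∈ T, p.Prime
  /-- `T` contains the residue characteristics of the bad places `S` -/
  S_sub : ∀ v ∈ X.S, residueChar F v ∈ T
  /-- the theta-idele -/
  tΘ : M.LgpIdele X.lstar
  /-- it realises `P_Θ`: `ord_v(t_{Θ,j,v}) = j²·ord_v(q_v)/(2l)` on `S`, `0` off `S` -/
  tΘ_ord : ∀ (i : Fin X.lstar) (p : ℕ) (v : placesOver F p), M.ordv (tΘ i p v) = X.thetaPilot i v.1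
  /-- the `q`-idele (the same in every procession degree) -/
  tq : M.LgpIdele X.lstar
  /-- it realises `P_q` -/
  tq_ord : ∀ (i : Fin X.lstar) (p : ℕ) (v : placesOver F p), M.ordv (tq i p v) = X.qPilot v.1
  /-- `(O_𝕃(−P_Θ))^{Ind3}` -/
  ind3 : M.Ind3Datum tΘ
  /-- `hull(U_Θ)` is admissible (`−|log(Θ)| ∈ ℝ`) -/
  hull_adm : M.RegionAdm (M.hullUTheta ind3)

namespace DHData

open RegionEncoding

variable (D : DHData F)

/-- `−|log(Θ)|` at the DH level: `ln ν̄_𝕃(hull(U_Θ))` over `T`. [cite: DupuyHilado2025, §1 p. 4] -/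
def negLogThetaDH : ℝ := D.M.lnνL D.X.lstar D.T (D.M.hullUTheta D.ind3)

/-- `−|log(q)|` at the DH level: `ln ν̄_𝕃(O_𝕃(−P_q))` over `T`. [cite: DupuyHilado2025, §3.9] -/
def negAbsLogqDH : ℝ := D.M.lnνL D.X.lstar D.T (D.M.region D.tq)

/-! ## 3. Thm. 3.10.1 for the pilots -/

/-- A divisor is the sum over primes `p ∈ T` of its parts over `p`, when `T` (primes) contains the residue
characteristics of its support. [folklore] -/
theorem sum_sum_placesOver_of (E : FinDivisor F) (T : Finset ℕ) (hT : ∀ p ∈ T, p.Prime)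
    (hE : ∀ v, E v ≠ 0 → residueChar F v ∈ T) :
    (∑ p ∈ T, ∑ v : placesOver F p, FinDivisor.of v.1 (E v.1)) = E := by
  classical
  ext w
  have hw := mem_placesOver_residueChar w
  haveI : Fact (residueChar F w).Prime := ⟨residueChar_prime F w⟩
  have inner : ∀ p ∈ T, (∑ v : placesOver F p, FinDivisor.of v.1 (E v.1)) w =
      if w ∈ placesOver F p then E w else 0 := by
    intro p _
    rw [Finsupp.finsetSum_apply, Finset.sum_coe_sort (placesOver F p) (fun v => (FinDivisor.of v (E v)) w)]
    simp only [FinDivisor.of, Finsupp.single_apply]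
    exact Finset.sum_ite_eq' (placesOver F p) w E
  rw [Finsupp.finsetSum_apply, Finset.sum_congr rfl inner]
  by_cases hEw : E w = 0
  · rw [hEw]; simp
  · rw [Finset.sum_eq_single (residueChar F w)]
    · simp [hw]
    · intro p hp hne
      haveI : Fact p.Prime := ⟨hT p hp⟩
      rw [if_neg]
      rw [mem_placesOver_iff_residueChar]
      exact fun h => hne h.symm
    · intro h; exact absurd (hE w hEw) h

/-- `div_T(t_Θ) = P_Θ`. [cite: DupuyHilado2025, §3.9] -/
theorem div_tΘ : PacketModel.LgpIdele.div D.M.toPacketModel D.tΘ D.T = D.X.thetaPilot := by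
  funext i
  unfold PacketModel.LgpIdele.div
  simp_rw [D.tΘ_ord i]
  refine sum_sum_placesOver_of (D.X.thetaPilot i) D.T D.T_prime fun v hv => D.S_sub v ?_
  by_contra h
  apply hv
  show (∑ w ∈ D.X.S, FinDivisor.of w ((((i : ℕ) + 1 : ℝ) ^ 2) * (D.X.ordq w : ℝ) / (2 * D.X.l))) v = 0
  classical
  rw [Finsupp.finsetSum_apply]
  exact Finset.sum_eq_zero fun w hw => by
    rw [FinDivisor.of, Finsupp.single_apply, if_neg (show ¬ (w = v) from fun hwv => h (hwv ▸ hw))]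

/-- `div_T(t_q) = (P_q, …, P_q)`. [cite: DupuyHilado2025, §3.9] -/
theorem div_tq : PacketModel.LgpIdele.div D.M.toPacketModel D.tq D.T = fun _ => D.X.qPilot := by
  funext i
  unfold PacketModel.LgpIdele.div
  simp_rw [D.tq_ord i]
  refine sum_sum_placesOver_of D.X.qPilot D.T D.T_prime fun v hv => D.S_sub v ?_
  by_contra h
  apply hv
  show (∑ w ∈ D.X.S, FinDivisor.of w ((D.X.ordq w : ℝ) / (2 * D.X.l))) v = 0
  classical
  rw [Finsupp.finsetSum_apply]
  exact Finset.sum_eq_zero fun w hw => by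
    rw [FinDivisor.of, Finsupp.single_apply, if_neg (show ¬ (w = v) from fun hwv => h (hwv ▸ hw))]

/-- **Thm. 3.10.1 at `P_Θ`**: `ln ν̄_𝕃(O_𝕃(−P_Θ)) = −deĝ̲_lgp(P_Θ)`. [cite: DupuyHilado2025, Thm. 3.10.1] -/
theorem lnνL_regionΘ :
    D.M.lnνL D.X.lstar D.T (D.M.region D.tΘ) = -LgpDivisor.ndegLgp D.X.thetaPilot := by
  rw [D.M.lnνL_region_eq_neg_ndegLgp D.tΘ D.T D.T_prime, div_tΘ]

/-- **Thm. 3.10.1 at `P_q`**: `ln ν̄_𝕃(O_𝕃(−P_q)) = −deĝ̲(P_q)`. [cite: DupuyHilado2025, Thm. 3.10.1] -/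
theorem lnνL_regionq :
    D.M.lnνL D.X.lstar D.T (D.M.region D.tq) = -FinDivisor.ndeg F D.X.qPilot := by
  haveI : NeZero D.X.lstar := ⟨by have := D.X.two_le_lstar; omega⟩
  rw [D.M.lnνL_region_eq_neg_ndegLgp D.tq D.T D.T_prime, div_tq, LgpDivisor.ndegLgp_eq,
    LgpDivisor.degLgp_const, FinDivisor.ndeg_apply]

/-! ## 4. (1.1) as `Cor312DH`, and what it costs -/

/-- **Dupuy–Hilado (1.1)**: "`−deĝ(P_q) ≤ −deĝ_lgp(P_{hull(U_Θ)})`", with "`ln ν̄_𝕃(hull(U_Θ)) =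
−deĝ_lgp(P_{hull(U_Θ)})`" (p. 4) — i.e. `−deĝ̲(P_q) ≤ ln ν̄_𝕃(hull(U_Θ))` for THIS data. HYPOTHESIS
(Mochizuki's Cor. 3.12 as Dupuy–Hilado print it); never asserted. [claim: Mochizuki2012, status: disputed] -/
@[claim "Mochizuki2012" "disputed"]
def Cor312DH : Prop := -FinDivisor.ndeg F D.X.qPilot ≤ D.negLogThetaDH

/-- (1.1) unfolded with Thm. 3.10.1 at `P_q`: `ln ν̄_𝕃(O_𝕃(−P_q)) ≤ ln ν̄_𝕃(hull(U_Θ))`, i.e. "`−|log(q)| ≤ −|log(Θ)|`"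
with both sides DH log-volumes. [cite: DupuyHilado2025, §1 (1.1), Thm. 3.10.1] -/
theorem cor312DH_iff_logvol : D.Cor312DH ↔ D.negAbsLogqDH ≤ D.negLogThetaDH := by
  rw [Cor312DH, negAbsLogqDH, lnνL_regionq]

/-- **(1.1) ⟺ inflation**: (1.1) holds iff the indeterminacies and the hull inflate `O_𝕃(−P_Θ)` by at least
`deĝ̲_lgp(P_Θ) − deĝ̲(P_q)` (`= ((l+1)/24 − 1/(2l))·deĝ̲(𝔮) > 0`, `PilotDivisors`). [claim: Mochizuki2012, status: disputed] -/
theorem cor312DH_iff_inflation :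
    D.Cor312DH ↔ LgpDivisor.ndegLgp D.X.thetaPilot - FinDivisor.ndeg F D.X.qPilot ≤
      D.negLogThetaDH - D.M.lnνL D.X.lstar D.T (D.M.region D.tΘ) := by
  rw [Cor312DH, lnνL_regionΘ]
  constructor <;> intro h <;> linarith

/-- The gap to be inflated is POSITIVE: `deĝ̲(P_q) < deĝ̲_lgp(P_Θ)` (`PilotDivisors.deg_qPilot_lt_degLgp_thetaPilot`
divided by `[F:ℚ]`; Mochizuki's (Syp2)). [cite: DupuyHilado2025, §3.3] -/
theorem ndeg_qPilot_lt_ndegLgp_thetaPilot :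
    FinDivisor.ndeg F D.X.qPilot < LgpDivisor.ndegLgp D.X.thetaPilot := by
  rw [FinDivisor.ndeg_apply, LgpDivisor.ndegLgp_eq]
  exact div_lt_div_of_pos_right D.X.deg_qPilot_lt_degLgp_thetaPilot FinDivisor.finrank_pos

/-- Hence (1.1) needs STRICT inflation of the bare region: `ln ν̄_𝕃(O_𝕃(−P_Θ)) < ln ν̄_𝕃(hull(U_Θ))`.
[claim: Mochizuki2012, status: disputed] -/
theorem lnνL_region_lt_of_cor312DH (h : D.Cor312DH) :
    D.M.lnνL D.X.lstar D.T (D.M.region D.tΘ) < D.negLogThetaDH := by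
  have h1 := (cor312DH_iff_inflation D).mp h
  have h2 := ndeg_qPilot_lt_ndegLgp_thetaPilot D
  linarith

/-- **The free inequality** `−deĝ̲_lgp(P_Θ) ≤ ln ν̄_𝕃(hull(U_Θ))`, unconditionally: `O_𝕃(−P_Θ)` lies in the
possible image of the identity indeterminacies, which lies in the hull; monotonicity of `ln ν̄_𝕃`.
[cite: DupuyHilado2025, §4.10–4.12] -/
theorem free_inequality : -LgpDivisor.ndegLgp D.X.thetaPilot ≤ D.negLogThetaDH := by
  rw [← lnνL_regionΘ, negLogThetaDH]
  refine D.M.lnνL_mono D.X.lstar D.T (D.M.region_adm D.tΘ) D.hull_adm fun p j e => ?_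
  exact (D.M.region_subset_UTheta_one D.ind3 p j e).trans (D.M.UTheta_le_hullUTheta D.ind3 _ p j e)

/-- Every possible image has ONE log-volume, that of `(O_𝕃(−P_Θ))^{Ind3}` (`MultiradialRegion.lnνL_UTheta`).
[cite: DupuyHilado2025, §4.7, §4.9, §4.11] -/
theorem lnνL_UTheta (lam : D.M.Ind2Elt × D.M.Ind1Elt) :
    D.M.lnνL D.X.lstar D.T (D.M.UTheta D.ind3 lam) = D.M.lnνL D.X.lstar D.T D.ind3.bare3 :=
  D.M.lnνL_UTheta D.ind3 lam D.T

/-! ## 5. Orbits of (Ind1), (Ind2); the squeeze with the multiradial estimate -/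

/-- Two regions are (Ind1)/(Ind2)-EQUIVALENT if one is `g·σ·` the other (the "orbit relation" form of the
indeterminacies on subsets of the volume container; TRANCHE-T1 P10). [cite: DupuyHilado2025, §4.7, §4.9] -/
def IndRel (A B : D.M.Region) : Prop := ∃ (g : D.M.Ind2Elt) (σ : D.M.Ind1Elt), B = D.M.ind2 g (D.M.ind1 σ A)

/-- `ln ν̄_𝕃` is CONSTANT on (Ind1)/(Ind2)-orbits of admissible regions (`MultiradialRegion.lnνL_ind1/2`, i.e.
reduced to the summand-level fields `logμ_perm`/`logμ_smul`). [cite: DupuyHilado2025, §4.7, §4.9] -/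
theorem lnνL_eq_of_indRel {A B : D.M.Region} (hA : D.M.RegionAdm A) (h : D.IndRel A B) :
    D.M.lnνL D.X.lstar D.T B = D.M.lnνL D.X.lstar D.T A := by
  obtain ⟨g, σ, rfl⟩ := h
  rw [D.M.lnνL_ind2 g (D.M.ind1_adm σ hA), D.M.lnνL_ind1 σ hA]

/-- Every possible image is in the orbit of `(O_𝕃(−P_Θ))^{Ind3}`. [cite: DupuyHilado2025, §4.11] -/
theorem indRel_bare3_UTheta (lam : D.M.Ind2Elt × D.M.Ind1Elt) :
    D.IndRel D.ind3.bare3 (D.M.UTheta D.ind3 lam) :=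
  ⟨lam.1, lam.2, rfl⟩

/-- The multiradial ESTIMATE at the DH level: `ln ν̄_𝕃(hull(U_Θ)) ≤ ln ν̄_𝕃(O_𝕃(−P_Θ)) + δ` — [IUTchIV]
Thm. 1.10 Steps (iv)–(x) would supply `δ`. HYPOTHESIS. [claim: Mochizuki2012, status: disputed] -/
@[claim "Mochizuki2012" "disputed"]
def EstimateDH (δ : ℝ) : Prop := D.negLogThetaDH ≤ D.M.lnνL D.X.lstar D.T (D.M.region D.tΘ) + δ

/-- **The squeeze with real degrees**: (1.1) and the estimate with discrepancy `δ` give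
`deĝ̲_lgp(P_Θ) − deĝ̲(P_q) ≤ δ`. [claim: Mochizuki2012, status: disputed] -/
theorem gap_le_of_cor312DH_of_estimateDH {δ : ℝ} (h1 : D.Cor312DH) (h2 : D.EstimateDH δ) :
    LgpDivisor.ndegLgp D.X.thetaPilot - FinDivisor.ndeg F D.X.qPilot ≤ δ := by
  have := (cor312DH_iff_inflation D).mp h1
  unfold EstimateDH at h2
  linarith

/-- … i.e. `deĝ̲(P_q) ≤ δ/(w̄ − 1)` with `w̄ = (ℓ⋇+1)(2ℓ⋇+1)/6` the average of the weights `j²` (a Diophantine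
bound on the normalised degree of the `q`-pilot divisor of `(F, j_E, S, l)`). [claim: Mochizuki2012, status: disputed] -/
theorem ndeg_qPilot_le_of_squeeze {δ : ℝ} (h1 : D.Cor312DH) (h2 : D.EstimateDH δ) :
    FinDivisor.ndeg F D.X.qPilot ≤ δ / (((D.X.lstar : ℝ) + 1) * (2 * D.X.lstar + 1) / 6 - 1) := by
  have hgap := gap_le_of_cor312DH_of_estimateDH D h1 h2
  have hw : 0 < ((D.X.lstar : ℝ) + 1) * (2 * D.X.lstar + 1) / 6 - 1 := by
    have := D.X.one_lt_avgWeight; linarith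
  have hΘ : LgpDivisor.ndegLgp D.X.thetaPilot =
      (((D.X.lstar : ℝ) + 1) * (2 * D.X.lstar + 1) / 6) * FinDivisor.ndeg F D.X.qPilot := by
    rw [LgpDivisor.ndegLgp_eq, D.X.degLgp_thetaPilot, FinDivisor.ndeg_apply]
    ring
  rw [le_div_iff₀ hw]
  rw [hΘ] at hgap
  linarith

end DHData

end Summit.ABC.IUTFork

end
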